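import Summits.BirchSwinnertonDyer.BirchSwinnertonDyer.Theorems.AlignedTransportAtTwoMainConjectureOfRankZeroBSDAtTwoCyclotomicLayerWeight
import Summits.BirchSwinnertonDyer.BirchSwinnertonDyer.Theorems.AlignedTransportAtTwoMainConjectureOfRankZeroBSDAtTwoCyclotomicLayerRankJumpExact
import Mathlib.RingTheory.PowerSeries.Ideal
import HarnessLib

/-!
# Route `AlignedTransportAtTwo`, crux C2 `MainConjectureOfRankZeroBSDAtTwo` (stmt-BirchSwinnertonDyer-22298):
# THE WEIGHT BUDGET AND THE MATCHING LAW — the Mordell–Weil rank of a good ordinary `E/ℚ` grows in AT MOST `ord_p L_p(E,0)` layers of the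
# cyclotomic `ℤ_p`-tower, and each growth layer `n+1` is matched by a prime factor of `L_p(E,T)` of degree `pⁿ(p−1)` AND weight one

HONEST FRAMING (cell `bsd-f1-sign2`, WIDTH-5 attached prover seat `bsd-line-att-p5` gen 37 on line `birth` of the lead `bsd-line-att-p2`;
`--supports` stmt-BirchSwinnertonDyer-22298, closes nothing; BSD is NOT proved by any of this; the crux C2, its verdict «blocked-on
`Rank1Residual.GreenbergMuConjectureIrreducible`» and every registered stub are untouched). THEOREMS ONLY — no `def`, no `sorry`, nothing asserted about
any curve. The ONE print binder is the lineage's `h17 : kato_divisibility_allPrimes W p` (Kato 2004 Thm. 17.4 (1)(2)) at ANY good ordinary prime `p`.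

THE POINT. g36 (`…CyclotomicLayerLFunction`): growth of `rank W(ℚ_n)` in the layer `ℚ_{n+1}/ℚ_n` puts the prime `Ψ_n = Φ_{p^{n+1}}(1+T)` into every integral
lift `G` of `L_p(f,α)`, whence the DEGREE budget `∑_{growth layers} pⁿ(p−1) ≤ λ(G)`. The companion algebra file (`…CyclotomicLayerWeight`, this gen) adds
that `Ψ_n` has WEIGHT ONE (`‖Ψ_n(0)‖ = p⁻¹`). Consequences, all modulo PRINT `h17` only:

* §1 `norm_constantCoeff_lift_eq` — the dictionary **`‖G(0)‖ = ‖#Ẽ(𝔽_p)‖²·‖[0]⁺_f‖`** (`L_p(E,0) = (1−α⁻¹)²·L(E,1)/Ω⁺`, `1 − α⁻¹ = unit·#Ẽ(𝔽_p)`; tree, any `p`).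
* §2 ★★ `norm_constantCoeff_lift_le_of_growthLayers` — **for every finite set `S` of layers `n` with `rank W(ℚ_n) < rank W(ℚ_{n+1})`: `‖G(0)‖ ≤ p^{−#S}`**;
  ★★ `card_growthLayers_le` — **`‖G(0)‖ = p^{−w} ⇒ #S ≤ w`: THE MORDELL–WEIL RANK GROWS IN AT MOST `ord_p L_p(E,0) = 2·ord_p #Ẽ(𝔽_p) + ord_p [0]⁺_f` LAYERS
  OF THE CYCLOTOMIC `ℤ_p`-TOWER** — independent of (and for large `λ` much sharper than) the degree budget; `mordellWeilRank_layer_succ_eq_of_norm_constantCoeff_lift_eq_one`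
  (`p ∤ #Ẽ(𝔽_p)·[0]⁺_f` ⇒ no growth at any layer).
* §3 ★★ `exists_mem_factors_associated_of_mordellWeilRank_lt` — THE MATCHING LAW: **growth at layer `n+1` ⇒ the prime factorisation of `G` in the UFD `Λ` contains a factor
  `P ~ Ψ_n`, with `λ(P) = pⁿ(p−1)`, `μ(P) = 0`, `‖P(0)‖ = p⁻¹`** (certified-factorisation form `exists_mem_associated_of_mordellWeilRank_lt`); contrapositive
  `mordellWeilRank_layer_succ_eq_of_forall_mem_factors` — **no prime factor of (degree, weight) `(pⁿ(p−1), 1)` ⇒ `rank W(ℚ_{n+1}) = rank W(ℚ_n)`**.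
* §4 (`p = 2`) THE PRIME-COFACTOR LAW for `G = (T+2)^k·H` with `H` irreducible (the shape of every certified row of the seed cell: `k = ord_{T=−2} L₂`, `H` Eisenstein or
  the weight-3 cofactor of the `λ₂ = 3` row): ★ `mordellWeilRank_layer_succ_eq_of_primeCofactor_of_norm_ne` (**`‖H(0)‖₂ ≠ ½ ⇒` no growth above `ℚ(√2)` at all**);
  ★★ `mordellWeilRank_layer_succ_eq_or_of_primeCofactor` (**one layer, `n ≥ 1`: `rank W(ℚ_{n+1}) = rank W(ℚ_n)` OR (`= rank W(ℚ_n) + 2ⁿ` EXACTLY ∧ `λ(H) = 2ⁿ` ∧ `H ~ Ψ_n`)**);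
  ★★ `mordellWeilRank_layer_eq_or_eq_add_of_primeCofactor` (**profile: ∀ `m ≥ 1`, `rank W(ℚ_m) = rank W(ℚ₁)` OR `= rank W(ℚ₁) + λ(H)` with `λ(H) = 2ⁿ`, `n < m`** — at most ONE jump
  above `ℚ(√2)`, of size exactly `deg H`, in the layer `2ⁿ = λ(H)`). The `a₂ = ±1` road rows are instances (companion `…CyclotomicLayerRoadNegative`; g36 `…RoadProfile` is `k = 1`).

References: K. Kato, Astérisque 295 (2004), Thm. 17.4 [Kato2004Asterisque]; R. Greenberg, LNM 1716 (1999), Thm. 1.9 (p. 63), §4 Thm. 4.1, §5 pp. 132, 176–177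
[GreenbergLNM1716]; B. Mazur, J. Tate, J. Teitelbaum, Invent. Math. 84 (1986), §I.14 (14.3) [MazurTateTeitelbaum1986Invent]; J. Balakrishnan, J. S. Müller,
W. Stein, Math. Comp. 85 (2016), remark after Thm. 1.7 [BalakrishnanMullerStein2015]; L. Washington, GTM 83, §7.1, §13.2 [Washington1997].
-/

set_option linter.dupNamespace false
set_option autoImplicit false

noncomputable section

open scoped Classical MatrixGroups ModularForm Polynomial

namespace Summit.BirchSwinnertonDyer.BirchSwinnertonDyer.Theorems.AlignedTransportAtTwoCyclotomicLayerWeightBudget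

open Polynomial CongruenceSubgroup WeierstrassCurve Literature.NumberTheory.EllipticCurves
  Literature.NumberTheory.EllipticCurves.ModularForms
  Literature.NumberTheory.EllipticCurves.Rank1Residual
  Literature.NumberTheory.EllipticCurves.Greenberg1999
  Summit.BirchSwinnertonDyer.Rank1Residual
  Summit.BirchSwinnertonDyer.Rank1Residual.X1.MuLambda
  Summit.BirchSwinnertonDyer.Rank1Residual.X1.ParitySqueeze
  Summit.BirchSwinnertonDyer.Rank1Residual.Iwasawa
  Summit.BirchSwinnertonDyer.Rank1Residual.F1Sign2
  Summit.BirchSwinnertonDyer.BirchSwinnertonDyer.Theorems.AlignedTransportAtTwoTwoFixedPoints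
  Summit.BirchSwinnertonDyer.BirchSwinnertonDyer.Theorems.AlignedTransportAtTwoEisensteinRigidity
  Summit.BirchSwinnertonDyer.BirchSwinnertonDyer.Theorems.AlignedTransportAtTwoEisensteinRigidityPrime
  Summit.BirchSwinnertonDyer.BirchSwinnertonDyer.Theorems.AlignedTransportAtTwoCyclotomicLayerPrime
  Summit.BirchSwinnertonDyer.BirchSwinnertonDyer.Theorems.AlignedTransportAtTwoCyclotomicLayerRankGrowth
  Summit.BirchSwinnertonDyer.BirchSwinnertonDyer.Theorems.AlignedTransportAtTwoCyclotomicLayerRankDichotomy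
  Summit.BirchSwinnertonDyer.BirchSwinnertonDyer.Theorems.AlignedTransportAtTwoCyclotomicLayerRankBudget
  Summit.BirchSwinnertonDyer.BirchSwinnertonDyer.Theorems.AlignedTransportAtTwoCyclotomicLayerLFunction
  Summit.BirchSwinnertonDyer.BirchSwinnertonDyer.Theorems.AlignedTransportAtTwoCyclotomicLayerRankJumpExact
  Summit.BirchSwinnertonDyer.BirchSwinnertonDyer.Theorems.AlignedTransportAtTwoCyclotomicLayerWeight
  Summit.BirchSwinnertonDyer.BirchSwinnertonDyer.Theorems.DefectPrime

variable {p : ℕ} [hp : Fact p.Prime]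

variable (W : WeierstrassCurve ℚ) [W.IsElliptic] [W.IsGloballyMinimal]

/-! ## §1 The dictionary `‖L_p(0)‖ = ‖#Ẽ(𝔽_p)‖²·‖[0]⁺_f‖` for an integral lift, any good ordinary `p` -/

/-- **`‖G(0)‖ = ‖#Ẽ(𝔽_p)‖²·‖[0]⁺_f‖`** for every integral lift `G` of `L_p(f,α)` (`ι G = L_p(f,α)`) at a good ordinary prime `p`: `L_p(0) = (1−α⁻¹)²·[0]⁺_f`
(MTT (14.3)) and `1 − α⁻¹ = u·#Ẽ(𝔽_p)`, `u ∈ ℤ_pˣ` (tree `exists_unit_one_sub_unitRoot_inv`). So `ord_p G(0) = 2·ord_p #Ẽ(𝔽_p) + ord_p [0]⁺_f` — the WEIGHT BUDGET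
of §2 in the curve's currency. (The lineage's `norm_constantCoeff_padicLFunction_eq` is `p = 2`.)
[cite: MazurTateTeitelbaum1986Invent, §I.14 (14.3)] [cite: BalakrishnanMullerStein2015, Thm. 1.7 (remark following)] -/
theorem norm_constantCoeff_lift_eq {N : ℕ} [NeZero N] {f : CuspForm (Gamma0 N) 2} (hord : IsOrdinaryAt W p) (hf : IsNewformOf W f)
    {G : IwasawaAlgebra p} (hG : iwasawaToPowerSeries p G = padicLFunction f (unitRoot W p : ℚ_[p])) :
    ‖PowerSeries.constantCoeff G‖ = ‖(W.reductionPointCount p : ℚ_[p])‖ ^ 2 * ‖(ratPlusSymbol f 0 : ℚ_[p])‖ := by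
  have hl : ((PowerSeries.constantCoeff G : ℤ_[p]) : ℚ_[p]) = PowerSeries.constantCoeff (padicLFunction f (unitRoot W p : ℚ_[p])) := by
    rw [← hG, ← PowerSeries.coeff_zero_eq_constantCoeff_apply, ← PowerSeries.coeff_zero_eq_constantCoeff_apply]
    exact (Wuthrich2014.coeff_iwasawaToPowerSeries p G 0).symm
  obtain ⟨u, hu⟩ := exists_unit_one_sub_unitRoot_inv p W hord
  have hu1 : ‖((u : ℤ_[p]) : ℚ_[p])‖ = 1 := by
    rw [← PadicInt.norm_def]; exact PadicInt.isUnit_iff.mp u.isUnit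
  rw [PadicInt.norm_def, hl, constantCoeff_padicLFunction_unitRoot hord hf, norm_mul, norm_pow, hu, norm_mul, hu1, one_mul]

/-! ## §2 The weight budget of rank growth -/

/-- ★★ **THE WEIGHT BUDGET: `‖L_p(0)‖ ≤ p^{−#(growth layers)}`.** `W/ℚ` globally minimal, good ordinary at `p`, `f` a newform of `W` (any level) with PRINT `h17`
(Kato 17.4 (1)(2) at `p`); `G ∈ Λ` an integral lift of `L_p(f,α)`; `κ` the cyclotomic `ℤ_p`-extension with normalised topological generator `γ`. For every finite set `S`
of layers `n` with `rank W(ℚ_n) < rank W(ℚ_{n+1})`: **`‖G(0)‖ ≤ p^{−#S}`** — each growth layer puts its prime `Φ_{p^{n+1}}(1+T)` into `G` (g36), all at once, and each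
weighs `p` at `T = 0`. [cite: Kato2004Asterisque, Thm. 17.4 (1)(2) (p. 273)] [cite: GreenbergLNM1716, Thm. 1.9 (p. 63) and §5 p. 132] -/
theorem norm_constantCoeff_lift_le_of_growthLayers {N : ℕ} [NeZero N] {f : CuspForm (Gamma0 N) 2}
    (h17 : kato_divisibility_allPrimes W p (f := f)) (hord : IsOrdinaryAt W p) (hf : IsNewformOf W f)
    {G : IwasawaAlgebra p} (hG : iwasawaToPowerSeries p G = padicLFunction f (unitRoot W p : ℚ_[p]))
    {κ : ZpExtension ℚ p} {γ : Field.absoluteGaloisGroup ℚ} (hκ : κ.IsCyclotomic) (hγ : κ.IsTopGenerator γ)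
    (hγ' : IsCyclotomicVariable p γ) (S : Finset ℕ)
    (hS : ∀ n ∈ S, (W.baseChange (κ.layer n)).mordellWeilRank < (W.baseChange (κ.layer (n + 1))).mordellWeilRank) :
    ‖PowerSeries.constantCoeff G‖ ≤ (p : ℝ)⁻¹ ^ S.card :=
  norm_constantCoeff_le_of_forall_cyclotomicLayer_dvd S fun n hn ↦
    cyclotomicLayer_dvd_lift_of_mordellWeilRank_lt W h17 hord hf hG hκ hγ hγ' (hS n hn)

/-- ★★ **THE MORDELL–WEIL RANK GROWS IN AT MOST `ord_p L_p(E,0)` LAYERS**: with the hypotheses of `norm_constantCoeff_lift_le_of_growthLayers`, if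
`‖G(0)‖ = p^{−w}` then every finite set of growth layers has **at most `w` elements** (`w = 2·ord_p #Ẽ(𝔽_p) + ord_p [0]⁺_f` by §1). E.g. `w = 1`: the rank can grow in ONE
layer of the whole tower, wherever `λ` sits. [cite: Kato2004Asterisque, Thm. 17.4 (1)(2) (p. 273)] [cite: GreenbergLNM1716, Thm. 1.9 (p. 63)] -/
theorem card_growthLayers_le {N : ℕ} [NeZero N] {f : CuspForm (Gamma0 N) 2}
    (h17 : kato_divisibility_allPrimes W p (f := f)) (hord : IsOrdinaryAt W p) (hf : IsNewformOf W f)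
    {G : IwasawaAlgebra p} (hG : iwasawaToPowerSeries p G = padicLFunction f (unitRoot W p : ℚ_[p])) {w : ℕ}
    (hw : ‖PowerSeries.constantCoeff G‖ = (p : ℝ)⁻¹ ^ w)
    {κ : ZpExtension ℚ p} {γ : Field.absoluteGaloisGroup ℚ} (hκ : κ.IsCyclotomic) (hγ : κ.IsTopGenerator γ)
    (hγ' : IsCyclotomicVariable p γ) (S : Finset ℕ)
    (hS : ∀ n ∈ S, (W.baseChange (κ.layer n)).mordellWeilRank < (W.baseChange (κ.layer (n + 1))).mordellWeilRank) : S.card ≤ w :=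
  card_le_of_forall_cyclotomicLayer_dvd S hw fun n hn ↦
    cyclotomicLayer_dvd_lift_of_mordellWeilRank_lt W h17 hord hf hG hκ hγ hγ' (hS n hn)

/-- **Weight zero ⇒ no growth anywhere**: `‖G(0)‖ = 1` (`p ∤ #Ẽ(𝔽_p)` and `[0]⁺_f` a `p`-unit, by §1) ⇒ `rank W(ℚ_{n+1}) = rank W(ℚ_n)` at EVERY layer
(`G ∈ Λˣ`: the classical trivial-Selmer corner, here modulo `h17` only). [cite: Kato2004Asterisque, Thm. 17.4 (1)(2) (p. 273)] [cite: GreenbergLNM1716, §4 Thm. 4.1 (p. 86)] -/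
theorem mordellWeilRank_layer_succ_eq_of_norm_constantCoeff_lift_eq_one {N : ℕ} [NeZero N] {f : CuspForm (Gamma0 N) 2}
    (h17 : kato_divisibility_allPrimes W p (f := f)) (hord : IsOrdinaryAt W p) (hf : IsNewformOf W f)
    {G : IwasawaAlgebra p} (hG : iwasawaToPowerSeries p G = padicLFunction f (unitRoot W p : ℚ_[p]))
    (hw : ‖PowerSeries.constantCoeff G‖ = 1)
    {κ : ZpExtension ℚ p} {γ : Field.absoluteGaloisGroup ℚ} (hκ : κ.IsCyclotomic) (hγ : κ.IsTopGenerator γ)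
    (hγ' : IsCyclotomicVariable p γ) (n : ℕ) :
    (W.baseChange (κ.layer (n + 1))).mordellWeilRank = (W.baseChange (κ.layer n)).mordellWeilRank := by
  rcases mordellWeilRank_layer_succ_eq_or_cyclotomicLayer_dvd_lift W h17 hord hf hG hκ hγ hγ' n with h | h
  · exact h
  · exact absurd h (not_cyclotomicLayer_dvd_of_norm_constantCoeff_eq_one hw n)

/-- **Weight zero ⇒ the rank is the same at every layer** (`rank W(ℚ_m) = rank W(ℚ_0)` for all `m`). [cite: Kato2004Asterisque, Thm. 17.4 (1)(2) (p. 273)] -/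
theorem mordellWeilRank_layer_eq_layer_zero_of_norm_constantCoeff_lift_eq_one {N : ℕ} [NeZero N] {f : CuspForm (Gamma0 N) 2}
    (h17 : kato_divisibility_allPrimes W p (f := f)) (hord : IsOrdinaryAt W p) (hf : IsNewformOf W f)
    {G : IwasawaAlgebra p} (hG : iwasawaToPowerSeries p G = padicLFunction f (unitRoot W p : ℚ_[p]))
    (hw : ‖PowerSeries.constantCoeff G‖ = 1)
    {κ : ZpExtension ℚ p} {γ : Field.absoluteGaloisGroup ℚ} (hκ : κ.IsCyclotomic) (hγ : κ.IsTopGenerator γ)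
    (hγ' : IsCyclotomicVariable p γ) (m : ℕ) :
    (W.baseChange (κ.layer m)).mordellWeilRank = (W.baseChange (κ.layer 0)).mordellWeilRank := by
  induction m with
  | zero => rfl
  | succ m ih => rw [mordellWeilRank_layer_succ_eq_of_norm_constantCoeff_lift_eq_one W h17 hord hf hG hw hκ hγ hγ' m, ih]

/-! ## §3 The matching law: each growth layer is a weight-one prime factor of `L_p` of the layer's degree -/

/-- ★★ **THE MATCHING LAW (certified factorisation).** Hypotheses of §2; `G = C(p^m)·∏ S` with every member of the multiset `S` PRIME in `Λ`. Growth at layer `n+1`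
⇒ **some `P ∈ S` has `P ~ Φ_{p^{n+1}}(1+T)`, `λ(P) = pⁿ(p−1)`, `μ(P) = 0`, `‖P(0)‖ = p⁻¹`**: the layer is carried by ONE prime factor of the SAME degree AND weight one.
[cite: Kato2004Asterisque, Thm. 17.4 (1)(2) (p. 273)] [cite: Washington1997, §13.2] [cite: GreenbergLNM1716, §5 p. 177] -/
theorem exists_mem_associated_of_mordellWeilRank_lt {N : ℕ} [NeZero N] {f : CuspForm (Gamma0 N) 2}
    (h17 : kato_divisibility_allPrimes W p (f := f)) (hord : IsOrdinaryAt W p) (hf : IsNewformOf W f)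
    {G : IwasawaAlgebra p} (hG : iwasawaToPowerSeries p G = padicLFunction f (unitRoot W p : ℚ_[p]))
    {S : Multiset (PowerSeries ℤ_[p])} (hS : ∀ P ∈ S, Prime P) {m : ℕ} (hGS : G = PowerSeries.C ((p : ℤ_[p]) ^ m) * S.prod)
    {κ : ZpExtension ℚ p} {γ : Field.absoluteGaloisGroup ℚ} (hκ : κ.IsCyclotomic) (hγ : κ.IsTopGenerator γ)
    (hγ' : IsCyclotomicVariable p γ) {n : ℕ}
    (hlt : (W.baseChange (κ.layer n)).mordellWeilRank < (W.baseChange (κ.layer (n + 1))).mordellWeilRank) :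
    ∃ P ∈ S, Associated ((((cyclotomic (p ^ (n + 1)) ℤ_[p]).comp (X + 1) : ℤ_[p][X]) : PowerSeries ℤ_[p])) P ∧
      lam P = p ^ n * (p - 1) ∧ mu P = 0 ∧ ‖PowerSeries.constantCoeff P‖ = (p : ℝ)⁻¹ := by
  have h := cyclotomicLayer_dvd_lift_of_mordellWeilRank_lt W h17 hord hf hG hκ hγ hγ' hlt
  rw [hGS] at h
  exact exists_mem_associated_of_cyclotomicLayer_dvd_C_pow_mul_prod S hS h

/-- ★★ **THE MATCHING LAW (the prime factorisation in the UFD `Λ`).** Hypotheses of §2. Growth at layer `n+1` ⇒ **`UniqueFactorizationMonoid.factors G` contains a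
`P ~ Φ_{p^{n+1}}(1+T)`, with `λ(P) = pⁿ(p−1)`, `μ(P) = 0` and weight one `‖P(0)‖ = p⁻¹`** (`G ≠ 0` by Rohrlich). So the set of growth layers INJECTS into the weight-one
prime factors of `L_p`, layer `n+1 ↦` a factor of degree exactly `φ(p^{n+1})`. [cite: Kato2004Asterisque, Thm. 17.4 (1)(2) (p. 273)] [cite: Washington1997, §7.1 and §13.2]
[cite: RohrlichInventiones1984, Theorem (p. 409)] -/
theorem exists_mem_factors_associated_of_mordellWeilRank_lt {N : ℕ} [NeZero N] {f : CuspForm (Gamma0 N) 2}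
    (h17 : kato_divisibility_allPrimes W p (f := f)) (hord : IsOrdinaryAt W p) (hf : IsNewformOf W f)
    {G : IwasawaAlgebra p} (hG : iwasawaToPowerSeries p G = padicLFunction f (unitRoot W p : ℚ_[p]))
    {κ : ZpExtension ℚ p} {γ : Field.absoluteGaloisGroup ℚ} (hκ : κ.IsCyclotomic) (hγ : κ.IsTopGenerator γ)
    (hγ' : IsCyclotomicVariable p γ) {n : ℕ}
    (hlt : (W.baseChange (κ.layer n)).mordellWeilRank < (W.baseChange (κ.layer (n + 1))).mordellWeilRank) :
    ∃ P ∈ UniqueFactorizationMonoid.factors (G : PowerSeries ℤ_[p]),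
      Associated ((((cyclotomic (p ^ (n + 1)) ℤ_[p]).comp (X + 1) : ℤ_[p][X]) : PowerSeries ℤ_[p])) P ∧
        lam P = p ^ n * (p - 1) ∧ mu P = 0 ∧ ‖PowerSeries.constantCoeff P‖ = (p : ℝ)⁻¹ := by
  have hG0 : G ≠ 0 := by
    intro h0
    rw [h0, map_zero] at hG
    exact padicLFunction_unitRoot_ne_zero hord hf hG.symm
  have h := cyclotomicLayer_dvd_lift_of_mordellWeilRank_lt W h17 hord hf hG hκ hγ hγ' hlt
  obtain ⟨P, hP, hass⟩ := UniqueFactorizationMonoid.exists_mem_factors_of_dvd hG0 (prime_coe_cyclotomic_comp p n).irreducible h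
  exact ⟨P, hP, hass, lam_mu_norm_of_associated_cyclotomicLayer hass⟩

/-- ★ **STATIONARITY FROM THE FACTOR TABLE**: if NO prime factor of `G` has degree `pⁿ(p−1)` and weight one, then `rank W(ℚ_{n+1}) = rank W(ℚ_n)`. (The factor table
of `L_p` over `ℤ_p` — a finite `p`-adic computation — thus names every layer where the rank may grow.) [cite: Kato2004Asterisque, Thm. 17.4 (1)(2) (p. 273)] [cite: Washington1997, §13.2] -/
theorem mordellWeilRank_layer_succ_eq_of_forall_mem_factors {N : ℕ} [NeZero N] {f : CuspForm (Gamma0 N) 2}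
    (h17 : kato_divisibility_allPrimes W p (f := f)) (hord : IsOrdinaryAt W p) (hf : IsNewformOf W f)
    {G : IwasawaAlgebra p} (hG : iwasawaToPowerSeries p G = padicLFunction f (unitRoot W p : ℚ_[p]))
    {κ : ZpExtension ℚ p} {γ : Field.absoluteGaloisGroup ℚ} (hκ : κ.IsCyclotomic) (hγ : κ.IsTopGenerator γ)
    (hγ' : IsCyclotomicVariable p γ) {n : ℕ}
    (hno : ∀ P ∈ UniqueFactorizationMonoid.factors (G : PowerSeries ℤ_[p]), lam P ≠ p ^ n * (p - 1) ∨ ‖PowerSeries.constantCoeff P‖ ≠ (p : ℝ)⁻¹) :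
    (W.baseChange (κ.layer (n + 1))).mordellWeilRank = (W.baseChange (κ.layer n)).mordellWeilRank := by
  by_contra hne
  have hlt : (W.baseChange (κ.layer n)).mordellWeilRank < (W.baseChange (κ.layer (n + 1))).mordellWeilRank :=
    lt_of_le_of_ne (mordellWeilRank_layer_le_succ W κ n) (Ne.symm hne)
  obtain ⟨P, hP, -, hl, -, hw⟩ := exists_mem_factors_associated_of_mordellWeilRank_lt W h17 hord hf hG hκ hγ hγ' hlt
  rcases hno P hP with h | h
  · exact h hl
  · exact h hw

/-! ## §4 `p = 2`: the prime-cofactor law for `L₀ = (T+2)^k·H`, `H` irreducible -/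

section TwoAdic

variable (V : WeierstrassCurve ℚ) [V.IsElliptic] [V.IsGloballyMinimal]

/-- ★ **PRIME COFACTOR OF WEIGHT `≠ 1` ⇒ NO GROWTH ABOVE `ℚ(√2)`.** `V/ℚ` globally minimal, good ordinary at `2`, `f` a newform of `V` (any level) with PRINT `h17` at `2`;
`G = (T+2)^k·H` an integral lift of `L₂(f,α)` with `H` IRREDUCIBLE in `Λ` and `‖H(0)‖₂ ≠ ½`. Then **`rank V(ℚ_{n+1}) = rank V(ℚ_n)` for EVERY `n ≥ 1`**: a growth layer
above the first would put `Φ_{2^{n+1}}(1+T)` into `H` (it cannot divide `(T+2)^k`), forcing `H ~ Φ`, of weight one. (The `λ₂ = 3` row of the `a₂ = −1` road: `k = 1`, `‖H(0)‖₂ = ⅛`.)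
[cite: Kato2004Asterisque, Thm. 17.4 (1)(2) (p. 273)] [cite: GreenbergLNM1716, §5 pp. 176–177] -/
theorem mordellWeilRank_layer_succ_eq_of_primeCofactor_of_norm_ne {N : ℕ} [NeZero N] {f : CuspForm (Gamma0 N) 2}
    (h17 : kato_divisibility_allPrimes V 2 (f := f)) (hord : IsOrdinaryAt V 2) (hf : IsNewformOf V f)
    {G H : IwasawaAlgebra 2} (hG : iwasawaToPowerSeries 2 G = padicLFunction f (unitRoot V 2 : ℚ_[2])) {k : ℕ}
    (hGH : G = (PowerSeries.X + PowerSeries.C (2 : ℤ_[2])) ^ k * H) (hH : Irreducible H) (hw : ‖PowerSeries.constantCoeff H‖ ≠ (2 : ℝ)⁻¹)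
    {κ : ZpExtension ℚ 2} {γ : Field.absoluteGaloisGroup ℚ} (hκ : κ.IsCyclotomic) (hγ : κ.IsTopGenerator γ)
    (hγ' : IsCyclotomicVariable 2 γ) {n : ℕ} (hn : 1 ≤ n) :
    (V.baseChange (κ.layer (n + 1))).mordellWeilRank = (V.baseChange (κ.layer n)).mordellWeilRank := by
  rcases mordellWeilRank_layer_succ_eq_or_cyclotomicLayer_dvd_lift V h17 hord hf hG hκ hγ hγ' n with h | h
  · exact h
  · rw [hGH] at h
    exact absurd h (not_cyclotomicLayer_dvd_X_add_C_two_pow_mul_of_irreducible_of_norm_ne hH hw hn)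

/-- **… hence `rank V(ℚ_m) = rank V(ℚ₁)` for every `m ≥ 1`** (prime cofactor of weight `≠ 1`): the Mordell–Weil rank of `V` over the whole cyclotomic `ℤ₂`-tower is
reached at `ℚ₁ = ℚ(√2)`. [cite: Kato2004Asterisque, Thm. 17.4 (1)(2) (p. 273)] [cite: GreenbergLNM1716, Thm. 1.9 (p. 63)] -/
theorem mordellWeilRank_layer_eq_layer_one_of_primeCofactor_of_norm_ne {N : ℕ} [NeZero N] {f : CuspForm (Gamma0 N) 2}
    (h17 : kato_divisibility_allPrimes V 2 (f := f)) (hord : IsOrdinaryAt V 2) (hf : IsNewformOf V f)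
    {G H : IwasawaAlgebra 2} (hG : iwasawaToPowerSeries 2 G = padicLFunction f (unitRoot V 2 : ℚ_[2])) {k : ℕ}
    (hGH : G = (PowerSeries.X + PowerSeries.C (2 : ℤ_[2])) ^ k * H) (hH : Irreducible H) (hw : ‖PowerSeries.constantCoeff H‖ ≠ (2 : ℝ)⁻¹)
    {κ : ZpExtension ℚ 2} {γ : Field.absoluteGaloisGroup ℚ} (hκ : κ.IsCyclotomic) (hγ : κ.IsTopGenerator γ)
    (hγ' : IsCyclotomicVariable 2 γ) {m : ℕ} (hm : 1 ≤ m) :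
    (V.baseChange (κ.layer m)).mordellWeilRank = (V.baseChange (κ.layer 1)).mordellWeilRank := by
  induction m, hm using Nat.le_induction with
  | base => rfl
  | succ m hm ih => rw [mordellWeilRank_layer_succ_eq_of_primeCofactor_of_norm_ne V h17 hord hf hG hGH hH hw hκ hγ hγ' hm, ih]

/-- ★★ **ONE LAYER OF THE PRIME-COFACTOR LAW (`n ≥ 1`): `rank V(ℚ_{n+1}) = rank V(ℚ_n)`, OR (`rank V(ℚ_{n+1}) = rank V(ℚ_n) + 2ⁿ` EXACTLY ∧ `λ(H) = 2ⁿ` ∧ `H ~ Φ_{2^{n+1}}(1+T)`).**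
Hypotheses of `mordellWeilRank_layer_succ_eq_of_primeCofactor_of_norm_ne` without the weight condition. The exact jump is `2ⁿ·c` with `Φ^c ∣ G` (g36 `…RankJumpExact`); `Φ² ∤ (T+2)^k·H`
for `H` irreducible, so `c ≤ 1`, and `c = 1` forces `H ~ Φ`. [cite: Kato2004Asterisque, Thm. 17.4 (1)(2) (p. 273) and Thm. 18.4 (p. 281)] [cite: GreenbergLNM1716, §5 p. 177] -/
theorem mordellWeilRank_layer_succ_eq_or_of_primeCofactor {N : ℕ} [NeZero N] {f : CuspForm (Gamma0 N) 2}
    (h17 : kato_divisibility_allPrimes V 2 (f := f)) (hord : IsOrdinaryAt V 2) (hf : IsNewformOf V f)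
    {G H : IwasawaAlgebra 2} (hG : iwasawaToPowerSeries 2 G = padicLFunction f (unitRoot V 2 : ℚ_[2])) {k : ℕ}
    (hGH : G = (PowerSeries.X + PowerSeries.C (2 : ℤ_[2])) ^ k * H) (hH : Irreducible H)
    {κ : ZpExtension ℚ 2} {γ : Field.absoluteGaloisGroup ℚ} (hκ : κ.IsCyclotomic) (hγ : κ.IsTopGenerator γ)
    (hγ' : IsCyclotomicVariable 2 γ) {n : ℕ} (hn : 1 ≤ n) :
    (V.baseChange (κ.layer (n + 1))).mordellWeilRank = (V.baseChange (κ.layer n)).mordellWeilRank ∨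
      ((V.baseChange (κ.layer (n + 1))).mordellWeilRank = (V.baseChange (κ.layer n)).mordellWeilRank + 2 ^ n ∧ lam H = 2 ^ n ∧
        Associated ((((cyclotomic (2 ^ (n + 1)) ℤ_[2]).comp (X + 1) : ℤ_[2][X]) : PowerSeries ℤ_[2])) H) := by
  obtain ⟨c, hdvd, hc⟩ := exists_cyclotomicLayer_pow_dvd_lift_and_mordellWeilRank_eq V h17 hord hf hG hκ hγ hγ' n
  -- restate in this file's elaboration of `rank V(ℚ_m)`
  have hc' : (V.baseChange (κ.layer (n + 1))).mordellWeilRank = (V.baseChange (κ.layer n)).mordellWeilRank + 2 ^ n * (2 - 1) * c := hc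
  rw [hGH] at hdvd
  have hc1 : c ≤ 1 := by
    by_contra hlt
    exact (lam_eq_two_pow_of_cyclotomicLayer_dvd_X_add_C_two_pow_mul_of_irreducible hH hn (dvd_trans (dvd_pow_self _ (by omega)) hdvd)).2.2
      (dvd_trans (pow_dvd_pow _ (by omega)) hdvd)
  rcases Nat.le_one_iff_eq_zero_or_eq_one.mp hc1 with rfl | rfl
  · left; omega
  · right
    rw [pow_one] at hdvd
    obtain ⟨hass, hl, -⟩ := lam_eq_two_pow_of_cyclotomicLayer_dvd_X_add_C_two_pow_mul_of_irreducible hH hn hdvd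
    exact ⟨by omega, hl, hass⟩

/-- ★★ **THE PROFILE OF THE PRIME-COFACTOR LAW**: for every `m ≥ 1`, **`rank V(ℚ_m) = rank V(ℚ₁)` OR (`rank V(ℚ_m) = rank V(ℚ₁) + λ(H)` ∧ `λ(H) = 2ⁿ` for some `1 ≤ n < m`)** —
above `ℚ(√2)` the Mordell–Weil rank moves AT MOST ONCE, by exactly `deg H`, in the layer `ℚ_{n+1}/ℚ_n` with `2ⁿ = λ(H)` (two jumps at `n ≠ n'` would give `2ⁿ = λ(H) = 2^{n'}`).
[cite: Kato2004Asterisque, Thm. 17.4 (1)(2) (p. 273)] [cite: GreenbergLNM1716, Thm. 1.9 (p. 63) and §5 p. 177] -/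
theorem mordellWeilRank_layer_eq_or_eq_add_of_primeCofactor {N : ℕ} [NeZero N] {f : CuspForm (Gamma0 N) 2}
    (h17 : kato_divisibility_allPrimes V 2 (f := f)) (hord : IsOrdinaryAt V 2) (hf : IsNewformOf V f)
    {G H : IwasawaAlgebra 2} (hG : iwasawaToPowerSeries 2 G = padicLFunction f (unitRoot V 2 : ℚ_[2])) {k : ℕ}
    (hGH : G = (PowerSeries.X + PowerSeries.C (2 : ℤ_[2])) ^ k * H) (hH : Irreducible H)
    {κ : ZpExtension ℚ 2} {γ : Field.absoluteGaloisGroup ℚ} (hκ : κ.IsCyclotomic) (hγ : κ.IsTopGenerator γ)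
    (hγ' : IsCyclotomicVariable 2 γ) {m : ℕ} (hm : 1 ≤ m) :
    (V.baseChange (κ.layer m)).mordellWeilRank = (V.baseChange (κ.layer 1)).mordellWeilRank ∨
      ((V.baseChange (κ.layer m)).mordellWeilRank = (V.baseChange (κ.layer 1)).mordellWeilRank + lam H ∧
        ∃ n, 1 ≤ n ∧ n < m ∧ lam H = 2 ^ n) := by
  induction m, hm using Nat.le_induction with
  | base => exact Or.inl rfl
  | succ m hm ih =>
    rcases mordellWeilRank_layer_succ_eq_or_of_primeCofactor V h17 hord hf hG hGH hH hκ hγ hγ' hm with hst | ⟨hjump, hlam, -⟩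
    · rcases ih with h | ⟨h, n, hn1, hnm, hl⟩
      · exact Or.inl (hst.trans h)
      · exact Or.inr ⟨hst.trans h, n, hn1, Nat.lt_succ_of_lt hnm, hl⟩
    · rcases ih with h | ⟨-, n, -, hnm, hl⟩
      · refine Or.inr ⟨?_, m, hm, Nat.lt_succ_self m, hlam⟩
        rw [hjump, h, hlam]
      · -- a second jump: `2^m = λ(H) = 2^n` with `n < m`
        exfalso
        have h1 : 2 ^ n = 2 ^ m := by rw [← hl, hlam]
        exact (Nat.ne_of_lt hnm) (Nat.pow_right_injective le_rfl h1)

/-- **`λ(H)` not a power of two (with exponent `≥ 1`) ⇒ stationary above `ℚ(√2)`**: `(∀ n ≥ 1, λ(H) ≠ 2ⁿ) ⇒ rank V(ℚ_m) = rank V(ℚ₁)` for all `m ≥ 1`.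
[cite: Kato2004Asterisque, Thm. 17.4 (1)(2) (p. 273)] [cite: GreenbergLNM1716, §5 p. 177] -/
theorem mordellWeilRank_layer_eq_layer_one_of_primeCofactor_of_lam_ne {N : ℕ} [NeZero N] {f : CuspForm (Gamma0 N) 2}
    (h17 : kato_divisibility_allPrimes V 2 (f := f)) (hord : IsOrdinaryAt V 2) (hf : IsNewformOf V f)
    {G H : IwasawaAlgebra 2} (hG : iwasawaToPowerSeries 2 G = padicLFunction f (unitRoot V 2 : ℚ_[2])) {k : ℕ}
    (hGH : G = (PowerSeries.X + PowerSeries.C (2 : ℤ_[2])) ^ k * H) (hH : Irreducible H) (hl : ∀ n, 1 ≤ n → lam H ≠ 2 ^ n)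
    {κ : ZpExtension ℚ 2} {γ : Field.absoluteGaloisGroup ℚ} (hκ : κ.IsCyclotomic) (hγ : κ.IsTopGenerator γ)
    (hγ' : IsCyclotomicVariable 2 γ) {m : ℕ} (hm : 1 ≤ m) :
    (V.baseChange (κ.layer m)).mordellWeilRank = (V.baseChange (κ.layer 1)).mordellWeilRank := by
  rcases mordellWeilRank_layer_eq_or_eq_add_of_primeCofactor V h17 hord hf hG hGH hH hκ hγ hγ' hm with h | ⟨-, n, hn1, -, hln⟩
  · exact h
  · exact absurd hln (hl n hn1)

end TwoAdic

end Summit.BirchSwinnertonDyer.BirchSwinnertonDyer.Theorems.AlignedTransportAtTwoCyclotomicLayerWeightBudget
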